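import Summits.BirchSwinnertonDyer.BirchSwinnertonDyer.Theses.KatoDescentTamePotSupersingular
import Summits.BirchSwinnertonDyer.Rank1Residual.O6.X3WildOfKMCTorsionFreeMember
import HarnessLib

/-!
# Route `KatoDescentTamePotSupersingular` (rung K8, sub-rung B4 (t′), cell `bsd-potss`): the crux
# `TameLowerHalfRankZero` (L₀, item stmt-BirchSwinnertonDyer-19981) is the (t′) slice of the uniform node
# `PotGoodLowerHalfRankZero`, hence FOLLOWS FROM KMC_p at the `p`-torsion-free members over the image-free
# readings — the route's DescentGlue (a `--supports … --as helper` file)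

Two-layer shape of the crux (Route.md: "the (t′) rows of the uniform node `PotGoodLowerHalfRankZero`, the
descent target of KMC_p"): (1) `PotGoodLowerHalfRankZero → TameLowerHalfRankZero` is unconditional
bookkeeping (`(t′) ⇒ ord_p j ≥ 0` via `ClassO5.padicValRat_j_nonneg`); (2) the uniform node follows
from Kato's Main Conjecture 12.10 at the `p`-TORSION-FREE members of the isogeny classes (which exist for
every odd `p`, seat kmc part 10 / Mazur–Kenku) over the image-free readings of part 8a, by the tree
theorem `Additive.potGoodLowerHalfRankZero_of_kmc_torsionFree` (part 10, p408212). Composing gives the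
crux from KMC_p over displayed readings and the published facts Cassels, GZK, modularity, Mazur–Kenku.
CONDITIONAL (audit `proof.conditional`); the item is NOT closed; nothing about KMC or the readings is
asserted. Seat `bsd-potss-kmc` generation 6.

References: [Kato2004Asterisque] Conj. 12.10 (p. 224), §14.14 (p. 243), Prop. 14.16 (2) (p. 244);
[SilvermanAEC2009] IX.6 Ex. 6.4 (Mazur–Kenku); [Cassels1965ArithmeticVIII].
-/

set_option autoImplicit false
-- sibling precedent (`KatoDescentPotSupersingularAssembly.lean`): the directory name repeats the summit name
set_option linter.dupNamespace false

noncomputable section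

open scoped Classical

namespace Summit.BirchSwinnertonDyer.BirchSwinnertonDyer.Theorems

open WeierstrassCurve Literature.NumberTheory.EllipticCurves
  Literature.NumberTheory.EllipticCurves.Rank1Residual
  Literature.NumberTheory.EllipticCurves.Rank1Residual.Typed
  Summit.BirchSwinnertonDyer.Rank1Residual.Additive
  Summit.BirchSwinnertonDyer.Rank1Residual
  Summit.BirchSwinnertonDyer.BirchSwinnertonDyer.Theses.KatoDescentTamePotSupersingular

/-- **The (t′) lower half is a slice of the uniform lower half** (unconditional bookkeeping):
`PotGoodLowerHalfRankZero → TameLowerHalfRankZero`, since a (t′) pair is additive potentially good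
(`ClassO5.padicValRat_j_nonneg`). [folklore] -/
theorem tameLowerHalfRankZero_of_potGoodLowerHalfRankZero (h : PotGoodLowerHalfRankZero) :
    Summit.BirchSwinnertonDyer.BirchSwinnertonDyer.Theses.KatoDescentTamePotSupersingular.TameLowerHalfRankZero := by
  intro W _ _ p _ hr hp2 hadd hT
  have hO5 : ClassO5 W p := ⟨hp2, hadd, Or.inr hT⟩
  exact h W p hr hp2 hadd hO5.padicValRat_j_nonneg

variable {IsOf : ∀ (W : WeierstrassCurve ℚ) [W.IsElliptic] [W.IsGloballyMinimal] (p : ℕ) [Fact p.Prime],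
  KatoDescentDatum p → Prop}
variable {KMC : ∀ (W : WeierstrassCurve ℚ) [W.IsElliptic] [W.IsGloballyMinimal] (p : ℕ), Prop}

/-- **DescentGlue for the crux `TameLowerHalfRankZero`: KMC_p at the `p`-torsion-free additive potentially
good curves of analytic rank `0` ⟹ the (t′) lower half**, over the image-free readings of part 8a
(`TorsionFree.DescentCountReading`, `TorsionFree.RealizableOfKMC`), the interface lemma
`ReadsTrivialKMC`, and the published facts Cassels, GZK, modularity, Mazur–Kenku — by
`Additive.potGoodLowerHalfRankZero_of_kmc_torsionFree` (part 10) and the slice lemma above. Conditional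
over displayed hypotheses; nothing about Kato's objects is asserted; the item is not closed.
[cite: Kato2004Asterisque, Conj. 12.10 (p. 224), §14.14 (p. 243), Prop. 14.16 (2) (p. 244)]
[cite: SilvermanAEC2009, IX.6 Example 6.4] -/
theorem tameLowerHalfRankZero_of_kmc_torsionFree (hR : TorsionFree.DescentCountReading IsOf)
    (hreal : TorsionFree.RealizableOfKMC IsOf KMC) (hread : ReadsTrivialKMC IsOf KMC)
    (hCassels : bsdRHS_eq_of_isIsogenous) (hGZK : rank_eq_analyticRank_of_analyticRank_le_one)
    (hmod : hasEntireLFunction_rat) (hMK : mazurKenku_exists_cyclic_isogeny)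
    (hK : ∀ (W : WeierstrassCurve ℚ) [W.IsElliptic] [W.IsGloballyMinimal] (p : ℕ) [Fact p.Prime],
      W.analyticRank = 0 → p ≠ 2 → Addv W p → 0 ≤ padicValRat p W.j → ¬ p ∣ W.torsionOrder →
        KMC W p) :
    Summit.BirchSwinnertonDyer.BirchSwinnertonDyer.Theses.KatoDescentTamePotSupersingular.TameLowerHalfRankZero :=
  tameLowerHalfRankZero_of_potGoodLowerHalfRankZero
    (Additive.potGoodLowerHalfRankZero_of_kmc_torsionFree hR hreal hread hCassels hGZK hmod hMK hK)

end Summit.BirchSwinnertonDyer.BirchSwinnertonDyer.Theorems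

end
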